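import Summits.PneNP.PneNP.Theorems.ChebyshevTracialDesignCrossingPinAlgebra
import Summits.PneNP.PneNP.Theorems.ChebyshevTracialDesignVirtualValueUnique
import HarnessLib

/-!
# Cell pnp-psdrank, route `ChebyshevTracialDesign`: THE CROSSING-PIN LEMMA — a rectangle with one common crossing pin has design
# value `O(B·√(P_{D−4}·μ·ν))` for EVERY exact design of degree `D ≥ 4` (p1's (L2), the crossing cells of the r = 1 rung)

Harmonic backbone of the crux `TracialDecayExp20` (stmt-PneNP-19878), brick 23b (prover g7). Let `n` be even, `t = 2c'+1` with
`2t+2 ≤ n`, `(C, w)` an exact design of degree `D` (`4 ≤ D < t`, `Σ|w_c| ≤ B`), `e = {a, b}` an edge, `X` ANY family of `t`-cuts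
each CROSSED by `e`, and `Y` ANY set of perfect matchings each CONTAINING `e`. Then (`crossingPin_value_le`)

  `|Σ_{U ∈ X} Σ_{M ∈ Y} W(U, M)| ≤ B · √(P_{D−4} · μ(X) · ν(Y))`,   `P_K = Π_{i ≤ K/2} (2i+1)/(n−2i)`, `μ = |X|/C(n,t)`, `ν = |Y|/|PM|`.

No tightness, no junta/window hypothesis, no density hypothesis: ONE common crossing pin makes the virtual value vanish. Mechanism (MEMO-10):
split `1_X = χ_e·1_X = χ_e·f_{≤D−2} + χ_e·f_{>D−2}` with `χ_e = x_a + x_b − 2x_a x_b` the crossing indicator. (i) `χ_e·f_{≤D−2}` has degree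
`≤ D`, so the design prices it EXACTLY at `−(1/|PM|)·Σ_{M∈Y} Ẽ_M[χ_e·f_{≤D−2}] = 0` (brick 14 `lowDegree_rectangle_value_eq` + the
annihilation `…CrossingPinAlgebra.knapsack_sum_mulCross_eq_zero`: the knapsack pseudo-expectation around `M ∋ e` kills every multiple of `χ_e`).
(ii) `χ_e·f_{>D−2}` has NO harmonic component of degree `≤ D−4` (`crossHigh_layer_eq_zero`: multiplication by the degree-2 polynomial
`χ_e` moves Johnson layers by at most 2 — proved through lit's slice orthogonality `slice_sum_zeta_mul_zeta_cross` and the ladder inner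
products `ip_iterate_up_of_isHarmonic` / `ip_iterate_up_cross`), so bricks 18–19 (`weighted_value_truncation_explicit` at degree `D−4`)
bound its design value by `B·√(P_{D−4}·‖χ_e f_{>D−2}‖²/C(n,t)·ν) ≤ B·√(P_{D−4} μν)`.
This is the (L2) step of planner p1's crossing-pin decomposition for the `r = 1` rung (HOME/pnp-psdrank-p1/N2-SpreadStructure.md §CPD),
in its strongest form (one pin, arbitrary remainder, no reduced instance). [cite: Rothvoss2017, §2 and Lemma 7 (PDF pp. 6–8)]
[cite: Grigoriev2001, §1 and Lemma 1.4 (PDF p. 8)] [cite: LeePrakashDewolfYuen2016, App. B Lemma B.8, B.10 (arXiv text chunk 21)]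
Stature: support/instrument (the crossing-cell half of the r = 1 rung; the non-crossing / spread half (SNT) remains open). WHAT THIS IS
NOT: not the r = 1 rung, nothing on psd rank, no P-vs-NP content. Supports stmt-PneNP-19878.
-/

set_option linter.dupNamespace false -- `Summit.PneNP.PneNP.…`: summit = sub-problem (D-0017)

noncomputable section

namespace Summit.PneNP.PneNP.Theorems.ChebyshevTracialDesignCrossingPin

open Finset Polynomial Literature.Barriers.PneNP Literature.Combinatorics.Optimization Literature.Computability.Complexity
open Literature.Combinatorics.SimpleGraph.CycleSpace
open Literature.Combinatorics.AssociationSchemes Literature.Combinatorics.AssociationSchemes.JohnsonHarmonics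
open Literature.Combinatorics.AssociationSchemes.JohnsonSpectrum
open Summit.PneNP.PneNP.Theorems.ChebyshevTracialDesignLowDegreePricing
open Summit.PneNP.PneNP.Theorems.ChebyshevTracialDesignLevelTail
open Summit.PneNP.PneNP.Theorems.ChebyshevTracialDesignProfilePolynomial
open Summit.PneNP.PneNP.Theorems.ChebyshevTracialDesignProfileExtrapolation
open Summit.PneNP.PneNP.Theorems.ChebyshevTracialDesignVirtualValueUnique
open Summit.PneNP.PneNP.Theorems.ChebyshevTracialDesignCrossingPinAlgebra

variable {n : ℕ}

/-! ### §1 Ladder inner products: pairing a ladder sum with one layer -/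

/-- Truncated harmonic families are harmonic. -/
theorem isHarmonic_ite_high {K : ℕ} (p : ℕ → Finset (Fin n) → ℝ) (hp : ∀ j, IsHarmonic j (p j)) (j : ℕ) :
    IsHarmonic j (if K < j then p j else 0) := by
  split_ifs
  · exact hp j
  · exact IsHarmonic.zero j

/-- **Pairing a ladder sum against one layer**: for harmonic `g_i` (degree `i`) and `p'` harmonic of degree `j₀ ≤ t`,
`⟪Σ_{i≤t} (Wᵀ)^{t−i} g_i, (Wᵀ)^{t−j₀} p'⟫ = (Π_{i<t−j₀} λ_{j₀}(i)) · ⟪g_{j₀}, p'⟫` — the layers are mutually orthogonal.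
[cite: LeePrakashDewolfYuen2016, App. B Lemma B.8, B.10 (arXiv text chunk 21)] -/
theorem ip_ladderSum_ladder {t j₀ : ℕ} (hj₀ : j₀ ≤ t) (g : ℕ → Finset (Fin n) → ℝ) (hg : ∀ i, IsHarmonic i (g i))
    {p' : Finset (Fin n) → ℝ} (hp' : IsHarmonic j₀ p') :
    ip (∑ i ∈ range (t + 1), up^[t - i] (g i)) (up^[t - j₀] p') = (∏ i ∈ range (t - j₀), ladder n j₀ i) * ip (g j₀) p' := by
  rw [ip_sum_left, sum_eq_single_of_mem j₀ (mem_range.2 (by omega)) fun i hi hne => ?_, ip_iterate_up_of_isHarmonic hp']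
  have hit : i ≤ t := by have := mem_range.1 hi; omega
  rcases lt_or_gt_of_ne hne with h | h
  · -- `i < j₀`: the ladder over `g i` is longer by `j₀ − i ≥ 1`
    rw [ip_comm, show t - i = (t - j₀) + (j₀ - i) by omega]
    exact ip_iterate_up_cross (hg i) hp'.2 (by omega) _
  · rw [show t - j₀ = (t - i) + (i - j₀) by omega]
    exact ip_iterate_up_cross hp' (hg i).2 (by omega) _

/-! ### §2 Multiplication by a crossing indicator moves Johnson layers by at most two -/

/-- **The high part times a crossing indicator is orthogonal to every low layer.** For harmonic `p_j`, a truncation degree `K`, the high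
part `F = Σ_{j>K} (Wᵀ)^{t−j} p_j` on the `t`-sets (`2t ≤ n+1`), an edge `{a,b}` and `p'` harmonic of degree `j₀` with `j₀ + 2 ≤ K`:
`Σ_{|U|=t} F(U) · χ_{ab}(U) · ((Wᵀ)^{t−j₀} p')(U) = 0` (`χ_{ab}·(Wᵀ)^{t−j₀}p'` is a polynomial of degree `≤ j₀+2 ≤ K` on the slice, and
different degrees are orthogonal on every slice). [cite: LeePrakashDewolfYuen2016, App. B Lemma B.10 (arXiv text chunk 21)] -/
theorem sum_high_mul_cross_ladder_eq_zero {t K j₀ : ℕ} (htn : 2 * t ≤ n + 1) (hj₀K : j₀ + 2 ≤ K) (hKt : K ≤ t)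
    (p : ℕ → Finset (Fin n) → ℝ) (hp : ∀ j, IsHarmonic j (p j)) (a b : Fin n)
    {p' : Finset (Fin n) → ℝ} (hp' : IsHarmonic j₀ p') :
    ∑ U ∈ univ.powersetCard t, (∑ j ∈ range (t + 1), up^[t - j] (if K < j then p j else 0)) U *
      ((if Crosses U s(a, b) then (1 : ℝ) else 0) * (up^[t - j₀] p') U) = 0 := by
  classical
  -- the coefficient vector of `χ_{ab} · p'` and its harmonic decomposition on the slice
  set r' : Finset (Fin n) → ℝ := fun B => (if a ∈ B then p' B + p' (B.erase a) else 0) +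
      (if b ∈ B then p' B + p' (B.erase b) else 0) -
      2 * (if a ∈ B then (if b ∈ B then p' B + p' (B.erase b) else 0) +
        (if b ∈ B.erase a then p' (B.erase a) + p' ((B.erase a).erase b) else 0) else 0) with hr'
  have hp'0 : ∀ A : Finset (Fin n), j₀ < A.card → p' A = 0 := fun A hA => hp'.1 A (by omega)
  have hr'0 : ∀ B : Finset (Fin n), j₀ + 2 < B.card → r' B = 0 := fun B hB => by
    rw [hr']; exact mulCross_eq_zero_of_card a b p' hp'0 B hB
  obtain ⟨qs, hqs, hqs0, hzeta⟩ := exists_ladderSum_eq_zeta_of_degree_le (K := j₀ + 2) (by omega) hr'0 t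
  -- rewrite the integrand on the `t`-sets: `χ · (Wᵀ)^{t−j₀} p' = (t−j₀)! · zeta r' = (t−j₀)! · Σ_s (t−s)!·zeta qs_s`
  have hint : ∀ U ∈ univ.powersetCard t,
      (∑ j ∈ range (t + 1), up^[t - j] (if K < j then p j else 0)) U *
        ((if Crosses U s(a, b) then (1 : ℝ) else 0) * (up^[t - j₀] p') U) =
      ((t - j₀).factorial : ℝ) * ∑ j ∈ range (t + 1), ∑ s ∈ range (t + 1),
        ((t - j).factorial : ℝ) * ((t - s).factorial : ℝ) *
          (zeta (if K < j then p j else 0) U * zeta (qs s) U) := by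
    intro U hU
    have hUt : U.card = t := (mem_powersetCard.1 hU).2
    have h1 : (if Crosses U s(a, b) then (1 : ℝ) else 0) * (up^[t - j₀] p') U =
        ((t - j₀).factorial : ℝ) * zeta r' U := by
      rw [ladder_apply_eq_factorial_mul_zeta (by omega) hp'.1 hUt, hr', zeta_mulCross_apply a b p' U]
      split_ifs <;> ring
    rw [h1, hzeta U hUt, ladderSum_apply_eq_zeta _ (isHarmonic_ite_high p hp) hUt, map_sum, Finset.sum_apply,
      Finset.sum_apply, sum_mul, mul_sum, mul_sum]
    refine sum_congr rfl fun j hj => ?_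
    have hjt : j ≤ t := by have := mem_range.1 hj; omega
    rw [map_smul, Pi.smul_apply, smul_eq_mul, mul_sum, mul_sum]
    refine (sum_congr rfl fun s hs => ?_)
    have hst : s ≤ t := by have := mem_range.1 hs; omega
    rw [ladder_apply_eq_factorial_mul_zeta hst (hqs s).1 hUt]
    ring
  rw [sum_congr rfl hint, ← mul_sum, sum_comm]
  -- every cross term vanishes: degrees `j > K ≥ j₀ + 2 ≥ s` differ (or a factor is zero)
  have hterm : ∀ j ∈ range (t + 1), ∀ s ∈ range (t + 1),
      ∑ U ∈ univ.powersetCard t, ((t - j).factorial : ℝ) * ((t - s).factorial : ℝ) *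
        (zeta (if K < j then p j else 0) U * zeta (qs s) U) = 0 := by
    intro j _ s _
    rw [← mul_sum]
    by_cases hKj : K < j
    · by_cases hs : j₀ + 2 < s
      · rw [hqs0 s hs]; simp
      · rw [if_pos hKj, slice_sum_zeta_mul_zeta_cross (hp j) (hqs s) (by omega), mul_zero]
    · rw [if_neg hKj]; simp
  rw [sum_comm]
  simp only [sum_comm (s := univ.powersetCard t)]
  rw [sum_eq_zero fun j hj => sum_eq_zero fun s hs => hterm j hj s hs, mul_zero]

/-- **Low layers of `χ_{ab} · f_{>K}` vanish.** With `F` the high part (beyond `K ≤ t`, `2t ≤ n`) of a harmonic family `p` on the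
`t`-sets and `g` ANY harmonic layer decomposition of `U ↦ χ_{ab}(U)·F(U)` on the `t`-sets: `g_{j₀} = 0` for every `j₀ + 2 ≤ K`.
[cite: LeePrakashDewolfYuen2016, App. B Lemma B.8, B.10 (arXiv text chunk 21)] -/
theorem crossHigh_layer_eq_zero {t K j₀ : ℕ} (ht : 2 * t ≤ n) (hj₀K : j₀ + 2 ≤ K) (hKt : K ≤ t)
    (p : ℕ → Finset (Fin n) → ℝ) (hp : ∀ j, IsHarmonic j (p j)) (a b : Fin n)
    (g : ℕ → Finset (Fin n) → ℝ) (hg : ∀ j, IsHarmonic j (g j))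
    (hG : ∀ U ∈ univ.powersetCard t,
      (if Crosses U s(a, b) then (1 : ℝ) else 0) * (∑ j ∈ range (t + 1), up^[t - j] (if K < j then p j else 0)) U =
        (∑ j ∈ range (t + 1), up^[t - j] (g j)) U) :
    g j₀ = 0 := by
  have hj₀t : j₀ ≤ t := by omega
  -- pair `χ F` with the layer `(Wᵀ)^{t−j₀} g_{j₀}`: zero by §2, and `Π λ · ⟪g_{j₀}, g_{j₀}⟫` by §1
  have h0 := sum_high_mul_cross_ladder_eq_zero (by omega) hj₀K hKt p hp a b (hg j₀)
  have hhom : IsHomog t (up^[t - j₀] (g j₀)) := by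
    have h := isHomog_iterate_up (hg j₀).1 (t - j₀)
    rwa [Nat.add_sub_cancel' hj₀t] at h
  have h1 : ∑ U ∈ univ.powersetCard t, (∑ j ∈ range (t + 1), up^[t - j] (if K < j then p j else 0)) U *
      ((if Crosses U s(a, b) then (1 : ℝ) else 0) * (up^[t - j₀] (g j₀)) U) =
      ip (∑ j ∈ range (t + 1), up^[t - j] (g j)) (up^[t - j₀] (g j₀)) := by
    rw [← sum_powersetCard_mul_of_isHomog _ hhom]
    refine sum_congr rfl fun U hU => ?_
    rw [← hG U hU]
    ring
  rw [h1, ip_ladderSum_ladder hj₀t g hg (hg j₀)] at h0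
  have hpos := ladderProd_range_pos hj₀t ht
  rcases mul_eq_zero.1 h0 with h | h
  · exact absurd h hpos.ne'
  · exact eq_zero_of_ip_self_eq_zero h

/-! ### §3 Exact designs are exact in every lower degree -/

/-- An exact design of degree `D` is an exact design of every degree `D' ≤ D`. -/
theorem isExactDesign_of_le {t T D D' : ℕ} {Bv : ℝ} {C : Finset ℕ} {w : ℕ → ℝ} (h : IsExactDesign n t T D Bv C w)
    (hD' : D' ≤ D) : IsExactDesign n t T D' Bv C w :=
  ⟨h.1, h.2.1, h.2.2.1, h.2.2.2.1, h.2.2.2.2.1, fun P hP => h.2.2.2.2.2.1 P (hP.trans hD'), h.2.2.2.2.2.2⟩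

/-! ### §4 The crossing-pin lemma -/

/-- **The crossing-pin lemma.** For `n` even, an exact design `(n, t = 2c'+1, T, D, B, C, w)` with `4 ≤ D < t`, an edge `{a, b}`,
ANY family `X` of `t`-subsets each crossed by `{a, b}` and ANY set `Y` of perfect matchings each containing `{a, b}`:
`|Σ_U Σ_{M∈Y} levelWeight(U,M)·1_X(U)| ≤ B · √(P_{D−4} · (|X|/C(n,t)) · (|Y|/|PM|))`, `P_K = Π_{i<K/2+1} (2i+1)/(n−2i)`.
[cite: Rothvoss2017, §2 and Lemma 7 (PDF pp. 6–8)] [cite: Grigoriev2001, Lemma 1.4 (PDF p. 8)] -/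
theorem crossingPin_value_le {c' T D : ℕ} {Bv : ℝ} {C : Finset ℕ} {w : ℕ → ℝ} (hn : Even n)
    (hdes : IsExactDesign n (2 * c' + 1) T D Bv C w) (hD : D ≤ 2 * c') (hD4 : 4 ≤ D) (a b : Fin n)
    (X : Finset (Finset (Fin n))) (hX : X ⊆ univ.powersetCard (2 * c' + 1)) (hXcross : ∀ U ∈ X, Crosses U s(a, b))
    (Y : Finset (PMatch n)) (hY : ∀ M ∈ Y, s(a, b) ∈ M.1) :
    |∑ U : OddSet n, ∑ M ∈ Y, levelWeight n (2 * c' + 1) C w U M * (if U.1 ∈ X then (1 : ℝ) else 0)| ≤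
      Bv * Real.sqrt ((∏ i ∈ range ((D - 4) / 2 + 1), ((2 * i + 1 : ℝ) / ((n : ℝ) - 2 * i))) *
        ((X.card : ℝ) / (n.choose (2 * c' + 1) : ℝ)) * ((Y.card : ℝ) / (Fintype.card (PMatch n) : ℝ))) := by
  classical
  have ht : 2 * (2 * c' + 1) + 2 ≤ n := hdes.2.1
  have htn : 2 * (2 * c' + 1) ≤ n + 1 := by omega
  have ht2 : 2 * (2 * c' + 1) ≤ n := by omega
  have hB := hdes.2.2.2.2.2.2
  -- the indicator of `X` and its harmonic layers
  set f : Finset (Fin n) → ℝ := fun U => if U ∈ X then (1 : ℝ) else 0 with hf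
  have hfhom : IsHomog (2 * c' + 1) f := fun U hU => by
    rw [hf]; dsimp only; rw [if_neg (fun hUX => hU (mem_powersetCard.1 (hX hUX)).2)]
  obtain ⟨p, hp, hfp⟩ := exists_ladder_decomposition htn hfhom
  -- the low part at degree `K = D − 2` and its coefficient vector
  set K := D - 2 with hK
  set q : Finset (Fin n) → ℝ :=
    ∑ j ∈ range (2 * c' + 1 + 1), ((2 * c' + 1 - j).factorial : ℝ) • (if K < j then 0 else p j) with hq
  obtain ⟨U₀, hU₀⟩ : ∃ U : Finset (Fin n), U ∈ univ.powersetCard (2 * c' + 1) := by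
    have : (univ.powersetCard (2 * c' + 1) : Finset (Finset (Fin n))).Nonempty := by
      apply powersetCard_nonempty.2; rw [card_univ, Fintype.card_fin]; omega
    exact this
  have hq0 : ∀ A : Finset (Fin n), K < A.card → q A = 0 :=
    fun A hA => (lowPart_apply_eq_zeta K p hp (mem_powersetCard.1 hU₀).2).2 A hA
  -- the χ-multiple of the low part: priced exactly at zero
  set r : Finset (Fin n) → ℝ := fun B => (if a ∈ B then q B + q (B.erase a) else 0) +
      (if b ∈ B then q B + q (B.erase b) else 0) -
      2 * (if a ∈ B then (if b ∈ B then q B + q (B.erase b) else 0) +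
        (if b ∈ B.erase a then q (B.erase a) + q ((B.erase a).erase b) else 0) else 0) with hr
  have hr0 : ∀ B : Finset (Fin n), D < B.card → r B = 0 := fun B hB => by
    rw [hr]; exact mulCross_eq_zero_of_card a b q hq0 B (by omega)
  have hprice : ∑ U : OddSet n, ∑ M ∈ Y, levelWeight n (2 * c' + 1) C w U M * zeta r U.1 = 0 := by
    rw [lowDegree_rectangle_value_eq hdes r hr0 Y]
    have hM : ∀ M ∈ Y, ∑ A : {A : Finset (Fin n) // A.card ≤ D},
        r A.1 * knapsackMoment M.1.card (((2 * c' + 1 : ℕ) : ℝ) / 2) (M.1.filter fun e => ∃ v ∈ A.1, v ∈ e).card = 0 := by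
      intro M hM
      have hfull : ∑ B : Finset (Fin n),
          r B * knapsackMoment M.1.card (((2 * c' + 1 : ℕ) : ℝ) / 2) (M.1.filter fun e => ∃ v ∈ B, v ∈ e).card = 0 :=
        knapsack_sum_mulCross_eq_zero M (hY M hM) q (((2 * c' + 1 : ℕ) : ℝ) / 2)
      rw [← sum_subtype (univ.filter fun A : Finset (Fin n) => A.card ≤ D) (by simp)
        (fun A => r A * knapsackMoment M.1.card (((2 * c' + 1 : ℕ) : ℝ) / 2) (M.1.filter fun e => ∃ v ∈ A, v ∈ e).card)]
      rw [← hfull]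
      refine sum_subset (filter_subset _ _) fun A _ hA => ?_
      rw [mem_filter, not_and] at hA
      rw [hr0 A (by have := hA (mem_univ _); omega), zero_mul]
    rw [sum_congr rfl hM, sum_const_zero, mul_zero, neg_zero]
  -- the χ-multiple of the high part and its harmonic layers: all layers `≤ D − 4` vanish
  set F : Finset (Fin n) → ℝ := ∑ j ∈ range (2 * c' + 1 + 1), up^[2 * c' + 1 - j] (if K < j then p j else 0) with hF
  set G : Finset (Fin n) → ℝ := fun U => (if Crosses U s(a, b) then (1 : ℝ) else 0) * F U with hGdef
  have hFhom : IsHomog (2 * c' + 1) F := isHomog_ladderSum _ (isHarmonic_ite_high p hp)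
  have hGhom : IsHomog (2 * c' + 1) G := fun U hU => by rw [hGdef]; dsimp only; rw [hFhom U hU, mul_zero]
  obtain ⟨g, hg, hGg⟩ := exists_ladder_decomposition htn hGhom
  have hg0 : ∀ j, j + 2 ≤ K → g j = 0 := fun j hj =>
    crossHigh_layer_eq_zero (K := K) ht2 hj (by omega) p hp a b g hg fun U _ => by rw [← hGg]
  -- on the `t`-sets: `1_X = zeta r + G`
  have hsplit : ∀ (U : OddSet n) (M : PMatch n), levelWeight n (2 * c' + 1) C w U M * f U.1 =
      levelWeight n (2 * c' + 1) C w U M * zeta r U.1 + levelWeight n (2 * c' + 1) C w U M * G U.1 := by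
    intro U M
    by_cases hU : U.1.card = 2 * c' + 1
    · have hlow := (lowPart_apply_eq_zeta K p hp hU).1
      have hfU : f U.1 = zeta q U.1 + F U.1 := by
        rw [hfp, ladderSum_eq_low_add_high K p, Pi.add_apply, hlow]
      have hχ : f U.1 = (if Crosses U.1 s(a, b) then (1 : ℝ) else 0) * f U.1 := by
        by_cases hUX : U.1 ∈ X
        · rw [if_pos (hXcross U.1 hUX), one_mul]
        · have : f U.1 = 0 := by rw [hf]; dsimp only; rw [if_neg hUX]
          rw [this, mul_zero]
      rw [← mul_add, hr, zeta_mulCross_apply a b q U.1, hGdef]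
      dsimp only
      rw [hχ, hfU]
      split_ifs <;> ring
    · have h0 : levelWeight n (2 * c' + 1) C w U M = 0 := by
        rw [levelWeight]
        exact sum_eq_zero fun c _ => by rw [if_neg (fun h => hU (mem_Qset_iff.1 h).1)]
      rw [h0]; ring
  have hV : ∑ U : OddSet n, ∑ M ∈ Y, levelWeight n (2 * c' + 1) C w U M * f U.1 =
      ∑ U : OddSet n, ∑ M ∈ Y, levelWeight n (2 * c' + 1) C w U M * G U.1 := by
    rw [show (∑ U : OddSet n, ∑ M ∈ Y, levelWeight n (2 * c' + 1) C w U M * G U.1) =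
        ∑ U : OddSet n, ∑ M ∈ Y, levelWeight n (2 * c' + 1) C w U M * zeta r U.1 +
          ∑ U : OddSet n, ∑ M ∈ Y, levelWeight n (2 * c' + 1) C w U M * G U.1 by rw [hprice, zero_add],
      ← sum_add_distrib]
    refine Fintype.sum_congr _ _ fun U => ?_
    rw [← sum_add_distrib]
    exact sum_congr rfl fun M _ => hsplit U M
  -- brick 19 at degree `D − 4` for `G ⊗ 1_Y`: the virtual term vanishes since the layers `≤ D − 4` of `G` do
  have hdes' : IsExactDesign n (2 * c' + 1) T (D - 4) Bv C w := isExactDesign_of_le hdes (by omega)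
  have hGdec : ∀ U ∈ univ.powersetCard (2 * c' + 1), G U = (∑ j ∈ range (2 * c' + 1 + 1), up^[2 * c' + 1 - j] (g j)) U :=
    fun U _ => by rw [← hGg]
  have htr := weighted_value_truncation_explicit hn hdes' (by omega) G g hg hGdec (fun M => if M ∈ Y then (1 : ℝ) else 0)
  have hqG : (∑ j ∈ range (2 * c' + 1 + 1), ((2 * c' + 1 - j).factorial : ℝ) • (if D - 4 < j then 0 else g j)) = 0 := by
    refine sum_eq_zero fun j _ => ?_
    split_ifs with h
    · rw [smul_zero]
    · rw [hg0 j (by omega), smul_zero]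
  have hVG : ∑ U : OddSet n, ∑ M : PMatch n, levelWeight n (2 * c' + 1) C w U M * (G U.1 * (if M ∈ Y then (1 : ℝ) else 0)) =
      ∑ U : OddSet n, ∑ M ∈ Y, levelWeight n (2 * c' + 1) C w U M * G U.1 := by
    refine sum_congr rfl fun U _ => ?_
    rw [← sum_boole_mul_univ Y]
    exact sum_congr rfl fun M _ => by ring
  simp only [hqG, Pi.zero_apply, zero_mul, sum_const_zero, mul_zero, add_zero, hVG] at htr
  -- norms: `Σ G² ≤ Σ F² ≤ Σ f² = |X|`, `Σ 1_Y² = |Y|`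
  have hfY : ∑ M : PMatch n, (if M ∈ Y then (1 : ℝ) else 0) ^ 2 = (Y.card : ℝ) := sum_boole_sq_of_subset (subset_univ Y)
  have hfX : ∑ U ∈ univ.powersetCard (2 * c' + 1), f U ^ 2 = (X.card : ℝ) := by
    rw [hf]; exact sum_boole_sq_of_subset hX
  have hGX : ∑ U ∈ univ.powersetCard (2 * c' + 1), G U ^ 2 ≤ (X.card : ℝ) := by
    have h2 : ∑ U ∈ univ.powersetCard (2 * c' + 1), F U ^ 2 ≤ ∑ U ∈ univ.powersetCard (2 * c' + 1), f U ^ 2 := by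
      have h := (highPart_sum_eq_zero_and_sum_sq_le htn K p hp).2
      rw [← hfp] at h
      exact h
    rw [hfX] at h2
    refine le_trans (sum_le_sum fun U _ => ?_) h2
    show ((if Crosses U s(a, b) then (1 : ℝ) else 0) * F U) ^ 2 ≤ F U ^ 2
    split_ifs
    · rw [one_mul]
    · rw [zero_mul, zero_pow two_ne_zero]; exact sq_nonneg _
  have hPD := prod_atten_nonneg (n := n) (K := D - 4) (by omega)
  have hCn : (0 : ℝ) < n.choose (2 * c' + 1) := by exact_mod_cast Nat.choose_pos (by omega)
  have hw0 : 0 ≤ ∑ c ∈ C, |w c| := sum_nonneg fun c _ => abs_nonneg _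
  rw [hfY] at htr
  have hmono : Real.sqrt ((∏ i ∈ range ((D - 4) / 2 + 1), ((2 * i + 1 : ℝ) / ((n : ℝ) - 2 * i))) *
        ((∑ U ∈ univ.powersetCard (2 * c' + 1), G U ^ 2) / (n.choose (2 * c' + 1) : ℝ)) *
        ((Y.card : ℝ) / (Fintype.card (PMatch n) : ℝ))) ≤
      Real.sqrt ((∏ i ∈ range ((D - 4) / 2 + 1), ((2 * i + 1 : ℝ) / ((n : ℝ) - 2 * i))) *
        ((X.card : ℝ) / (n.choose (2 * c' + 1) : ℝ)) * ((Y.card : ℝ) / (Fintype.card (PMatch n) : ℝ))) :=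
    Real.sqrt_le_sqrt (mul_le_mul_of_nonneg_right
      (mul_le_mul_of_nonneg_left (div_le_div_of_nonneg_right hGX hCn.le) hPD) (by positivity))
  have hfin : ∑ U : OddSet n, ∑ M ∈ Y, levelWeight n (2 * c' + 1) C w U M * (if U.1 ∈ X then (1 : ℝ) else 0) =
      ∑ U : OddSet n, ∑ M ∈ Y, levelWeight n (2 * c' + 1) C w U M * G U.1 := hV
  rw [hfin]
  calc |∑ U : OddSet n, ∑ M ∈ Y, levelWeight n (2 * c' + 1) C w U M * G U.1|
      ≤ (∑ c ∈ C, |w c|) * Real.sqrt ((∏ i ∈ range ((D - 4) / 2 + 1), ((2 * i + 1 : ℝ) / ((n : ℝ) - 2 * i))) *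
          ((∑ U ∈ univ.powersetCard (2 * c' + 1), G U ^ 2) / (n.choose (2 * c' + 1) : ℝ)) *
          ((Y.card : ℝ) / (Fintype.card (PMatch n) : ℝ))) := htr
    _ ≤ Bv * Real.sqrt ((∏ i ∈ range ((D - 4) / 2 + 1), ((2 * i + 1 : ℝ) / ((n : ℝ) - 2 * i))) *
          ((X.card : ℝ) / (n.choose (2 * c' + 1) : ℝ)) * ((Y.card : ℝ) / (Fintype.card (PMatch n) : ℝ))) :=
        mul_le_mul hB hmono (Real.sqrt_nonneg _) (hw0.trans hB)

end Summit.PneNP.PneNP.Theorems.ChebyshevTracialDesignCrossingPin
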